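import Literature.AlgebraicGeometry.Resolution.FrobeniusNormLocalization
import Mathlib.RingTheory.Localization.Integer
import HarnessLib

/-!
# Frobenius norm ideals: extension to an ARBITRARY localisation inside `K`, and rescaling of the norm class
# (crux `FInjectiveMacaulayfication` stmt-ResolutionOfSingularities-15315, chain w45a; piece (L) of res-L1-w45a-lead-1 g8's TIER-2 FILE PLAN 06:27:54Z for LEMMA N♭ —
# «norm ideals extend along localisations A₀ → 𝒪_v inside K; rescaling β ↦ β′ absorbs x¹⁶»; seat res-L1-w45a-stub-1 g9)

[OURS · L1 W4.5a] Support file (`--supports stmt-ResolutionOfSingularities-15315 --as helper`); generic over the Literature `frobeniusNorm` /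
`IsFrobeniusNormIdeal` (`Literature/AlgebraicGeometry/Resolution/FrobeniusNormIdeal.lean`, `…FrobeniusNormLocalization.lean` — the latter has the COVERED case
`map_of_cover` / `map_of_isLocalization_away` only; localisation at a prime is not inside one `A[1/s]`); def-free, unconditional. AI-written (AI review is weaker than
expert review).

* §1 `frobeniusNorm_eq_span_of_isLocalization (β) (M) [IsLocalization M A']` — for ANY localisation `A → A' = M⁻¹A → K` (scalar tower): `[[F^e_* A']]_β = [[F^e_* A]]_β · A'`
  (common denominator `b ∈ M`: `m'_i = b^{q-1}a_i / b^q`, and `1/b^q ∈ K^q` comes out of `det_β` by multilinearity);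
  ★ `IsFrobeniusNormIdeal.map_of_isLocalization` — `I` a Frobenius norm ideal of `A` ⇒ `I·A'` one of `A'` (e.g. `A' = Localization.AtPrime 𝔪`, the stalk).
* §2 ★ `isFrobeniusNormIdeal_of_coeSubmodule_eq_map_mulLeft (β) (hv : v ≠ 0) (h : J·K = v · [[F^e_* A]]_β)` ⇒ `J` is a Frobenius norm ideal — the norm CLASS is closed under
  nonzero scalars of `K` (basis `β.unitsSMul`, `Module.Basis.det_unitsSMul`, `frobeniusNorm_basis_change`); corollary `IsFrobeniusNormIdeal.of_coeSubmodule_eq_map_mulLeft`.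

[folklore; cite: Villamayoru2006, 3.4 (localisation compatibility), §2 p. 123 (well defined up to the identification `⋀ʳ ≅ K`)]
-/

noncomputable section

open Literature.AlgebraicGeometry.Resolution

namespace Summit.ResolutionOfSingularities.ResolutionOfSingularities.Theorems.FInjectiveMacaulayfication.FrobeniusNormExtendScale

set_option linter.dupNamespace false

universe u v

variable {K : Type u} [Field K] {p : ℕ} [ExpChar K p] {e : ℕ}
variable {ι : Type v} [Fintype ι] [DecidableEq ι] (β : Module.Basis ι (iterateFrobeniusRange K p e) K)
variable {A : Type*} [CommRing A] [Algebra A K]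

/-! ## §1 Arbitrary localisations inside `K` -/

section Localization

variable {A' : Type*} [CommRing A'] [Algebra A' K] [Algebra A A'] [IsScalarTower A A' K]

/-- **Localisation compatibility of the Frobenius norm, general form**: for any localisation `A' = M⁻¹A` mapping to `K` over `A`,
`[[F^e_* A']]_β = [[F^e_* A]]_β · A'`. [cite: Villamayoru2006, 3.4] -/
theorem frobeniusNorm_eq_span_of_isLocalization (M : Submonoid A) [IsLocalization M A'] :
    frobeniusNorm β A' = Submodule.span A' (frobeniusNormSet β A) := by
  classical
  refine le_antisymm ?_ (span_frobeniusNormSet_le β A A')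
  rw [frobeniusNorm]
  refine Submodule.span_le.mpr ?_
  rintro d ⟨m', hm'⟩
  -- common denominator `b ∈ M`: `algebraMap A A' (a i) = b • m' i`
  obtain ⟨b, hb⟩ := IsLocalization.exist_integer_multiples_of_finite M m'
  choose a ha using hb
  have hbunit : IsUnit (algebraMap A A' (b : A)) := IsLocalization.map_units A' b
  set bK : K := algebraMap A K (b : A) with hbK
  have hbK' : algebraMap A' K (algebraMap A A' (b : A)) = bK := (IsScalarTower.algebraMap_apply A A' K _).symm
  have hbK0 : bK ≠ 0 := by rw [← hbK']; exact (hbunit.map (algebraMap A' K)).ne_zero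
  have hq : 0 < p ^ e := pow_pos (expChar_pos K p) e
  -- the scalar `c = bK^{-q} ∈ K^q`
  let c : iterateFrobeniusRange K p e := ⟨bK⁻¹ ^ p ^ e, mem_iterateFrobeniusRange_iff.mpr ⟨bK⁻¹, rfl⟩⟩
  have hcK : ((c : iterateFrobeniusRange K p e) : K) = bK⁻¹ ^ p ^ e := rfl
  -- `m'_i = c • algebraMap (b^{q-1} a_i)` in `K`
  have hmi : ∀ i, algebraMap A' K (m' i) = c • algebraMap A K ((b : A) ^ (p ^ e - 1) * a i) := by
    intro i
    have h1 : algebraMap A K (a i) = bK * algebraMap A' K (m' i) := by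
      rw [IsScalarTower.algebraMap_apply A A' K (a i), ha i, Algebra.smul_def, map_mul, hbK']
    change _ = (bK⁻¹ ^ p ^ e) * algebraMap A K ((b : A) ^ (p ^ e - 1) * a i)
    rw [map_mul, map_pow, ← hbK, h1, ← mul_assoc (bK ^ (p ^ e - 1)), ← pow_succ, Nat.sub_add_cancel hq, ← mul_assoc, ← mul_pow,
      inv_mul_cancel₀ hbK0, one_pow, one_mul]
  -- pull `c` out of `det_β`
  have hdet : (β.det fun i => algebraMap A' K (m' i)) =
      c ^ Fintype.card ι * β.det fun i => algebraMap A K ((b : A) ^ (p ^ e - 1) * a i) := by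
    have h := (β.det : K [⋀^ι]→ₗ[iterateFrobeniusRange K p e] (iterateFrobeniusRange K p e)).toMultilinearMap.map_smul_univ
      (fun _ => c) fun i => algebraMap A K ((b : A) ^ (p ^ e - 1) * a i)
    simp only [AlternatingMap.coe_multilinearMap, Finset.prod_const, Finset.card_univ, smul_eq_mul] at h
    rw [← h]
    congr 1
    funext i
    exact hmi i
  -- `d₀ := d · bK^r` is a norm from `A`
  set d₀ : K := d * bK ^ Fintype.card ι with hd₀
  have hd₀mem : d₀ ∈ frobeniusNormSet β A := by
    refine ⟨fun i => (b : A) ^ (p ^ e - 1) * a i, ?_⟩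
    have hm'' : d ^ p ^ e = (bK⁻¹ ^ p ^ e) ^ Fintype.card ι *
        ((β.det fun i => algebraMap A K ((b : A) ^ (p ^ e - 1) * a i) : iterateFrobeniusRange K p e) : K) := by
      rw [hm', hdet, Subfield.coe_mul, SubmonoidClass.coe_pow, hcK]
    rw [hd₀, mul_pow, hm'', ← pow_mul, ← pow_mul, mul_comm (p ^ e) (Fintype.card ι), mul_right_comm, ← mul_pow,
      inv_mul_cancel₀ hbK0, one_pow, one_mul]
  -- `d = (u⁻¹)^r • d₀` with `u` the unit `algebraMap A A' b` of `A'`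
  have hu : algebraMap A' K (↑(hbunit.unit⁻¹) : A') = bK⁻¹ := by
    apply eq_inv_of_mul_eq_one_left
    rw [← hbK', ← map_mul, IsUnit.val_inv_mul, map_one]
  have hd : d = ((↑(hbunit.unit⁻¹) : A') ^ Fintype.card ι) • d₀ := by
    rw [Algebra.smul_def, map_pow, hu, inv_pow, hd₀, mul_comm d, inv_mul_cancel_left₀ (pow_ne_zero _ hbK0)]
  rw [hd]
  exact Submodule.smul_mem _ _ (Submodule.subset_span hd₀mem)

end Localization

/-! ## §1b/§2 Consequences for `IsFrobeniusNormIdeal` (rings in the universe of `K`, as in the Literature definition) -/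

section NormIdeal

variable {B B' : Type u} [CommRing B] [CommRing B'] [Algebra B K] [Algebra B' K] [Algebra B B'] [IsScalarTower B B' K]

/-- ★ **Frobenius norm ideals extend along ANY localisation inside `K`**: `I` a Frobenius norm ideal of `B`, `B' = M⁻¹B → K` ⇒ `I·B'` is a Frobenius norm
ideal of `B'` (e.g. `B' = Localization.AtPrime 𝔪`). [cite: Villamayoru2006, 3.4] -/
theorem IsFrobeniusNormIdeal.map_of_isLocalization (M : Submonoid B) [IsLocalization M B'] {I : Ideal B}
    (hI : IsFrobeniusNormIdeal K p e I) : IsFrobeniusNormIdeal K p e (I.map (algebraMap B B')) := by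
  obtain ⟨ι, _, _, β, hβ⟩ := hI
  refine ⟨ι, inferInstance, inferInstance, β, ?_⟩
  rw [coeSubmodule_map_algebraMap, hβ, frobeniusNorm_eq_span_of_isLocalization (A := B) (A' := B') β M, frobeniusNorm,
    Submodule.span_span_of_tower]

/-- ★ **The Frobenius norm class is closed under nonzero scalars of `K`** (module form): if `J·K = v · [[F^e_* B]]_β` with `v ≠ 0`, then `J` is a Frobenius norm
ideal — witnessed by the rescaled basis `β.unitsSMul w` (`w = v^{-q}` at one index), whose norm module is `v ·` that of `β`. [folklore; cite: Villamayoru2006, §2 p. 123] -/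
theorem isFrobeniusNormIdeal_of_coeSubmodule_eq_map_mulLeft {ι : Type} [Fintype ι] [DecidableEq ι]
    (β : Module.Basis ι (iterateFrobeniusRange K p e) K) {J : Ideal B} {v : K} (hv : v ≠ 0)
    (h : IsLocalization.coeSubmodule K J = (frobeniusNorm β B).map (LinearMap.mulLeft B v)) :
    IsFrobeniusNormIdeal K p e J := by
  classical
  haveI : Nonempty ι := β.index_nonempty
  obtain ⟨i₀⟩ := ‹Nonempty ι›
  have hq : 0 < p ^ e := pow_pos (expChar_pos K p) e
  have hvq : (⟨v ^ p ^ e, mem_iterateFrobeniusRange_iff.mpr ⟨v, rfl⟩⟩ : iterateFrobeniusRange K p e) ≠ 0 := by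
    intro h0
    have : v ^ p ^ e = 0 := congrArg Subtype.val h0
    exact hv ((pow_eq_zero_iff hq.ne').mp this)
  let w₀ : (iterateFrobeniusRange K p e)ˣ := Units.mk0 _ hvq
  let w : ι → (iterateFrobeniusRange K p e)ˣ := fun i => if i = i₀ then w₀⁻¹ else 1
  have hprod : ∏ i, w i = w₀⁻¹ := by
    simp only [w, Finset.prod_ite_eq', Finset.mem_univ, if_true]
  have hv' : v ^ p ^ e = (((β.unitsSMul w).det β : iterateFrobeniusRange K p e) : K) := by
    rw [Module.Basis.det_unitsSMul, AlternatingMap.smul_apply, Module.Basis.det_self, smul_eq_mul, mul_one, hprod, inv_inv]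
    rfl
  exact ⟨ι, inferInstance, inferInstance, β.unitsSMul w, by rw [h, frobeniusNorm_basis_change (β := β) (β.unitsSMul w) hv']⟩

/-- ★ **Ideal form**: `I` a Frobenius norm ideal, `J·K = v · (I·K)` with `v ≠ 0` ⇒ `J` a Frobenius norm ideal. [folklore] -/
theorem IsFrobeniusNormIdeal.of_coeSubmodule_eq_map_mulLeft {I J : Ideal B} (hI : IsFrobeniusNormIdeal K p e I) {v : K} (hv : v ≠ 0)
    (h : IsLocalization.coeSubmodule K J = (IsLocalization.coeSubmodule K I).map (LinearMap.mulLeft B v)) :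
    IsFrobeniusNormIdeal K p e J := by
  obtain ⟨ι, _, _, β, hβ⟩ := hI
  rw [hβ] at h
  exact isFrobeniusNormIdeal_of_coeSubmodule_eq_map_mulLeft β hv h

end NormIdeal


end Summit.ResolutionOfSingularities.ResolutionOfSingularities.Theorems.FInjectiveMacaulayfication.FrobeniusNormExtendScale

end
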